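import Mathlib
import Literature.MathematicalPhysics.QuantumFieldTheory.Balaban1983to89.B6Prop26Norms
import Literature.MathematicalPhysics.QuantumFieldTheory.Balaban1983to89.B6Prop23Chain
import Literature.MathematicalPhysics.QuantumFieldTheory.Balaban1983to89.B6Prop26ChainGeneric
import Literature.MathematicalPhysics.QuantumFieldTheory.Balaban1983to89.B6Lemma21Repaired
import Literature.MathematicalPhysics.QuantumFieldTheory.Balaban1983to89.B6TowerSums

/-!
# `Balaban1983to89.B6Prop26NormsGeneric` — T. Bałaban, *Propagators and renormalization transformations for lattice gauge
theories. II*, Commun. Math. Phys. **96** (1984) 223–250 [Balaban1984PropagatorsII]: Proposition 2.6 (2.136)–(2.141)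
p. 247 IN GENERAL NORMS (the right-factor / Hölder / L² bookkeeping of `…B6Prop26Norms`, unit pv01) RE-DERIVED FOR AN
ARBITRARY CONSTANT `c` IN THE ROW-SUM BOUND (2.61) OF LEMMA 2.1 — THEOREM A (the series (2.141) in every output seminorm),
every entry with a right factor E (THEOREMS B/C bookkeeping), the printed entry |(G∇*J)(x)|, the commutator arrangement,
the whole table (2.136); then bound to the REPAIRED Lemma 2.1′ of the tree (`B6Lemma21Repaired.Lemma21Repaired`) instead
of the printed `B6.Lemma21Printed` (refuted as typed on multi-level geometries, GAPS G-B6-01a/b), and THEOREM A with the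
Lemma-2.1 inputs DISCHARGED on the multi-level tower family (`B6TowerSums.twGeo_ineq261With`)

statement-level skeleton of published theorems with citation tags; proofs where landed; nothing here is a claim about the Yang–Mills mass gap.
PDF held: `paper:balaban1984-cmp96-propagators-rt-ii` (journal page = PDF page + 222); pp. 232–234 [PDF 10–12], 239 [PDF 17],
247 [PDF 25] are the pages quoted (verbatim displays = the docstrings of `…B6Prop26Norms` / `…B6RandomWalk` / `…B6`,
certified against the ×2 renders by the block reader r03; those modules are imported and NOT modified).

CITATION HEADER (cell `lit-balaban`, reader/typer + fold-owner seat `r03` (gen 8) = unit `lit-balaban-r03`, HOME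
`run/shared/lean/pub/lit-balaban/`; SKELETON row **`B6.Prop2.6`** (cell only; head `typed-existing` unchanged) and the
DEPGRAPH §2f item *B6.Lem2.1 refuted-as-printed with proved dependants*).  Companion of this seat's
`…B6Prop26ChainGeneric` (the sup-norm chain, the glueing, Cor. 2.8 / (2.88)); THIS file does the same for the
general-norm machinery of `…B6Prop26Norms`, whose theorems `gMajorant_partialSums`, `gMajorant_of_fixedPoint` (THEOREM A),
`prop26_leftEntry_of_291`, `prop26_ioEntry_of_291`, `prop26_entry3_of_291`, `prop26_ioEntry_comm_of_291`,
`prop26_entry3_comm_of_291` and the wrappers `prop26_ioEntry_of_lemma21`, `prop26_entry3_of_lemma21`,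
`prop26_table2136_of_lemma21`, `prop26_entry3_comm_of_lemma21` hard-wire the PRINTED constant `B6.c1 d δ α`.  As there,
the proofs use of c₁ only `0 ≤ c₁`; they are repeated VERBATIM with `B6.c1 d δ α ↦ c`, `0 ≤ c` on the generic core
`B6Prop23Chain.majorant_pow_265W` (the abstract `GMajorant` calculus of `…B6Prop26Norms` — `gMajorant_mul`, `gMajorant_sum`,
`gMajorant_rightFactor`, `rightFactor_kernel`, `rightFactor_fixedPoint_comm`, `seminorm_opBound`, `len_transfer_sq_inv` —
is constant-free already and is consumed BY NAME).

WHAT IS PROVED (0 sorry, 0 defs, 0 new named facts; axioms standard):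
§1 `sum_kernel_266W`, `gMajorant_partialSumsW`, **`gMajorant_of_fixedPointW`** (THEOREM A for any c ≥ 0: G′ = G′₀ + G′R
   takes sup sources to N-outputs with majorant A·c·(1 − θc)⁻¹·P(o)·e^{−(1−α)δd(y_o,y′)} under θc < 1).
§2 `prop26_leftEntry_of_291W`, **`prop26_ioEntry_of_291W`** (every entry of (2.136)–(2.140), general sources S, output
   seminorms N, right factor E; O(1) = A₀ + A·c·(1 − θc)⁻¹·θ₂ΛC_c), `prop26_entry3_of_291W` (|(G∇*J)(x)|),
   `prop26_ioEntry_comm_of_291W` / `prop26_entry3_comm_of_291W` (the commutator arrangement, two generic constants c, c♯).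
§3 with the REPAIRED Lemma 2.1′ of the tree (c = c₁′ = `B6Lemma21Arith.c1Repaired d δ α` at each rate):
   `prop26_ioEntry_of_lemma21Repaired`, `prop26_entry3_of_lemma21Repaired`, **`prop26_table2136_of_lemma21Repaired`** (the
   whole printed table (2.136) [(L^jη)², L^jη, L^jη, 1] at once, left entries from
   `B6Prop26ChainGeneric.prop26_three_entries_of_lemma21Repaired`), `prop26_entry3_comm_of_lemma21Repaired`.
§4 ON THE MULTI-LEVEL TOWER FAMILY `twGeo d k a m L η R`: **`gMajorant_of_fixedPoint_tower`** — THEOREM A with (2.61)/(2.63),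
   (2.54), d(y,y) = 0, d ≥ 0 DISCHARGED (`B6TowerSums.twGeo_ineq261With`/`twGeo_ineq263With`, constant K_TW uniform in
   k; `B6LevelTower.twGeo_hyps266`), on geometries where the printed c₁ is refuted (`B6Lemma21TowerD2`, G-B6-01b).
HONEST SCOPE.  As in `…B6Prop26Norms`: the four majorants ((2.133)/(2.135), the n = 0 inputs G₀E, the RE resp. R♯/R♭
inputs), (2.91), GΔ_a = I and the scale transfer stay the displayed / located hypotheses they are there; only the form of
Lemma 2.1 the chain binds changes.  No head changes.  Value = the §2f tension retired for the general-norm half of the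
Prop 2.6 chain, NOT summit progress.
-/

namespace Literature.MathematicalPhysics.QuantumFieldTheory.Balaban1983to89.B6Prop26NormsGeneric

open Finset
open B6RandomWalk (Ineq260 Triangle254 HasMajorant hasMajorant_mono fixedPoint_telescope)
open B6Prop26 (fixedPoint_of_291 left_mul_fixedPoint)
open B6Prop26Norms (SourceClass blockSrc evalN evalN_apply GMajorant hasMajorant_iff gMajorant_mono gMajorant_sum
  gMajorant_mul gMajorant_add seminorm_opBound right_mul_fixedPoint gMajorant_rightFactor rightFactor_kernel
  rightFactor_fixedPoint_comm len_transfer_sq_inv)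
open B6Lemma21Repaired (Ineq261With Ineq263With ineq263With_of_261With Lemma21Repaired c1Repaired_nonneg)
open B6Prop23Chain (majorant_pow_265W)

/-! ## §1. THEOREM A for an arbitrary (2.61)-constant -/

section General

variable {g : B6.Geometry} {X : Type} {O : Type}

/-- The y″-summation of (2.66) as a pure kernel inequality, for ANY constant `c` in (2.61): `Σ_{y″} e^{−δ₀d(a,y″)}
e^{−(1−α)δ₀d(y″,b)} ≤ c·e^{−(1−α)δ₀d(a,b)}` (pv01's `B6Prop26Norms.sum_kernel_266` with c₁ ↦ c).
[cite: Balaban1984PropagatorsII, (2.66) p.234 with (2.54), (2.61)] -/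
theorem sum_kernel_266W (c δ₀ α : ℝ) (hαδ : 0 ≤ (1 - α) * δ₀) (htri : Triangle254 g)
    (h261 : Ineq261With c g δ₀ α) (a b : g.Site) :
    ∑ y'' : g.Site, Real.exp (-(δ₀ * g.dist a y'')) * Real.exp (-((1 - α) * δ₀ * g.dist y'' b)) ≤
      c * Real.exp (-((1 - α) * δ₀ * g.dist a b)) := by
  have hterm : ∀ y'' : g.Site, Real.exp (-(δ₀ * g.dist a y'')) * Real.exp (-((1 - α) * δ₀ * g.dist y'' b)) ≤
      Real.exp (-((1 - α) * δ₀ * g.dist a b)) * Real.exp (-(α * δ₀ * g.dist a y'')) := by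
    intro y''
    rw [← Real.exp_add, ← Real.exp_add]
    refine Real.exp_le_exp.mpr ?_
    have := mul_le_mul_of_nonneg_left (htri a y'' b) hαδ
    nlinarith
  calc ∑ y'' : g.Site, Real.exp (-(δ₀ * g.dist a y'')) * Real.exp (-((1 - α) * δ₀ * g.dist y'' b))
      ≤ ∑ y'' : g.Site, Real.exp (-((1 - α) * δ₀ * g.dist a b)) * Real.exp (-(α * δ₀ * g.dist a y'')) :=
        Finset.sum_le_sum fun y'' _ => hterm y''
    _ = Real.exp (-((1 - α) * δ₀ * g.dist a b)) * ∑ y'' : g.Site, Real.exp (-(α * δ₀ * g.dist a y'')) := by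
        rw [Finset.mul_sum]
    _ ≤ Real.exp (-((1 - α) * δ₀ * g.dist a b)) * c :=
        mul_le_mul_of_nonneg_left (h261 a) (Real.exp_nonneg _)
    _ = c * Real.exp (-((1 - α) * δ₀ * g.dist a b)) := mul_comm _ _

/-- **The partial sums of (2.141) are bounded UNIFORMLY in every output norm**, for ANY constant `c ≥ 0` in (2.61)/(2.63)
(pv01's `B6Prop26Norms.gMajorant_partialSums` with c₁ ↦ c; the n-fold step is `B6Prop23Chain.majorant_pow_265W`): every
partial sum Σ_{n<M} G′₀Rⁿ takes sup sources to N-outputs with the majorant A·c·(1 − θc)⁻¹·P(o)·e^{−(1−α)δ₀d(y_o,y′)}.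
[cite: Balaban1984PropagatorsII, (2.141) p.247; (2.65)–(2.66) p.234] -/
theorem gMajorant_partialSumsW (blk : X → g.Site) (N : O → Seminorm ℝ (X → ℝ)) (oblk : O → g.Site)
    (c δ₀ α θ A : ℝ) (P : O → ℝ) (hA : 0 ≤ A) (hP : ∀ o, 0 ≤ P o) (hθ : 0 ≤ θ) (hc : 0 ≤ c)
    (hαδ : 0 ≤ (1 - α) * δ₀) (htri : Triangle254 g) (hrefl : ∀ y : g.Site, g.dist y y = 0)
    (h261 : Ineq261With c g δ₀ α) (h263 : Ineq263With c g δ₀ α) (hsmall : θ * c < 1)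
    {G0 R : Module.End ℝ (X → ℝ)}
    (hG0 : GMajorant (blockSrc blk) N G0 (fun o b => A * P o * Real.exp (-(δ₀ * g.dist (oblk o) b))))
    (hR : HasMajorant blk R (fun a b => θ * Real.exp (-(δ₀ * g.dist a b)))) (M : ℕ) :
    GMajorant (blockSrc blk) N (∑ n ∈ Finset.range M, G0 * R ^ n)
      (fun o b => A * c * (1 - θ * c)⁻¹ * P o * Real.exp (-((1 - α) * δ₀ * g.dist (oblk o) b))) := by
  set q : ℝ := θ * c with hq
  have hq0 : 0 ≤ q := mul_nonneg hθ hc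
  have hRn : ∀ n : ℕ, GMajorant (blockSrc blk) evalN (R ^ n)
      (fun x b => q ^ n * Real.exp (-((1 - α) * δ₀ * g.dist (blk x) b))) := fun n =>
    (hasMajorant_iff blk (R ^ n) _).mp (majorant_pow_265W blk c δ₀ α θ hθ hrefl h263 hR n)
  have hterm : ∀ n : ℕ, GMajorant (blockSrc blk) N (G0 * R ^ n)
      (fun o b => A * c * P o * q ^ n * Real.exp (-((1 - α) * δ₀ * g.dist (oblk o) b))) := by
    intro n
    refine gMajorant_mono (gMajorant_mul blk
      (K₂ := fun a b => q ^ n * Real.exp (-((1 - α) * δ₀ * g.dist a b))) hG0 (hRn n)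
      (fun a b => mul_nonneg (pow_nonneg hq0 n) (Real.exp_nonneg _))) fun o b => ?_
    have hs := sum_kernel_266W c δ₀ α hαδ htri h261 (oblk o) b
    have hC : 0 ≤ A * P o * q ^ n := mul_nonneg (mul_nonneg hA (hP o)) (pow_nonneg hq0 n)
    calc ∑ y'' : g.Site, A * P o * Real.exp (-(δ₀ * g.dist (oblk o) y'')) *
          (q ^ n * Real.exp (-((1 - α) * δ₀ * g.dist y'' b)))
        = A * P o * q ^ n * ∑ y'' : g.Site, Real.exp (-(δ₀ * g.dist (oblk o) y'')) *
            Real.exp (-((1 - α) * δ₀ * g.dist y'' b)) := by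
          rw [Finset.mul_sum]; exact Finset.sum_congr rfl fun _ _ => by ring
      _ ≤ A * P o * q ^ n * (c * Real.exp (-((1 - α) * δ₀ * g.dist (oblk o) b))) :=
          mul_le_mul_of_nonneg_left hs hC
      _ = _ := by ring
  refine gMajorant_mono (gMajorant_sum _ _ hterm M) fun o b => ?_
  have hgeom : ∑ n ∈ Finset.range M, q ^ n ≤ (1 - q)⁻¹ :=
    sum_le_hasSum (Finset.range M) (fun n _ => pow_nonneg hq0 n) (hasSum_geometric_of_lt_one hq0 hsmall)
  have hC : 0 ≤ A * c * P o * Real.exp (-((1 - α) * δ₀ * g.dist (oblk o) b)) :=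
    mul_nonneg (mul_nonneg (mul_nonneg hA hc) (hP o)) (Real.exp_nonneg _)
  calc ∑ n ∈ Finset.range M, A * c * P o * q ^ n * Real.exp (-((1 - α) * δ₀ * g.dist (oblk o) b))
      = A * c * P o * Real.exp (-((1 - α) * δ₀ * g.dist (oblk o) b)) * ∑ n ∈ Finset.range M, q ^ n := by
        rw [Finset.mul_sum]; exact Finset.sum_congr rfl fun _ _ => by ring
    _ ≤ A * c * P o * Real.exp (-((1 - α) * δ₀ * g.dist (oblk o) b)) * (1 - q)⁻¹ :=
        mul_le_mul_of_nonneg_left hgeom hC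
    _ = _ := by ring

/-- **THEOREM A for ANY constant `c ≥ 0` in (2.61)/(2.63)** (pv01's `B6Prop26Norms.gMajorant_of_fixedPoint` with c₁ ↦ c):
on a finite lattice with block map to 𝔅, if G′ = G′₀ + G′R ((2.141) via (2.91)), G′₀ takes sup sources to N-outputs with
majorant A·P(o)·e^{−δ₀d(y_o,y′)}, R has the (2.135)-majorant θe^{−δ₀d}, `Ineq261With c`/`Ineq263With c` hold at rate δ₀,
(2.54), d(y,y) = 0, d ≥ 0 and θc < 1, then G′ itself takes sup sources to N-outputs with majorant
A·c·(1 − θc)⁻¹·P(o)·e^{−(1−α)δ₀d(y_o,y′)} (remainder G′R^M → 0 by (2.65) and the finiteness of the lattice).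
[cite: Balaban1984PropagatorsII, Prop. 2.6 (2.141) p.247; Prop. 2.2 (2.64)–(2.67) p.234] -/
theorem gMajorant_of_fixedPointW [Fintype X] [DecidableEq X] (blk : X → g.Site) (N : O → Seminorm ℝ (X → ℝ))
    (oblk : O → g.Site) (c δ₀ α θ A : ℝ) (P : O → ℝ)
    (hA : 0 ≤ A) (hP : ∀ o, 0 ≤ P o) (hθ : 0 ≤ θ) (hc : 0 ≤ c) (hαδ : 0 ≤ (1 - α) * δ₀) (htri : Triangle254 g)
    (hrefl : ∀ y : g.Site, g.dist y y = 0) (hdnn : ∀ y y' : g.Site, 0 ≤ g.dist y y')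
    (h261 : Ineq261With c g δ₀ α) (h263 : Ineq263With c g δ₀ α) (hsmall : θ * c < 1)
    {G' G0 R : Module.End ℝ (X → ℝ)}
    (hG0 : GMajorant (blockSrc blk) N G0 (fun o b => A * P o * Real.exp (-(δ₀ * g.dist (oblk o) b))))
    (hR : HasMajorant blk R (fun a b => θ * Real.exp (-(δ₀ * g.dist a b)))) (hfix : G' = G0 + G' * R) :
    GMajorant (blockSrc blk) N G'
      (fun o b => A * c * (1 - θ * c)⁻¹ * P o * Real.exp (-((1 - α) * δ₀ * g.dist (oblk o) b))) := by
  have hpartial := gMajorant_partialSumsW blk N oblk c δ₀ α θ A P hA hP hθ hc hαδ htri hrefl h261 h263 hsmall hG0 hR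
  set q : ℝ := θ * c with hq
  have hq0 : 0 ≤ q := mul_nonneg hθ hc
  have hRn : ∀ n : ℕ, GMajorant (blockSrc blk) evalN (R ^ n)
      (fun x b => q ^ n * Real.exp (-((1 - α) * δ₀ * g.dist (blk x) b))) := fun n =>
    (hasMajorant_iff blk (R ^ n) _).mp (majorant_pow_265W blk c δ₀ α θ hθ hrefl h263 hR n)
  intro y' μ B hμ o
  obtain ⟨E, -, hEb⟩ := seminorm_opBound (N o) G'
  have hB : 0 ≤ B := (blockSrc blk).nonneg hμ
  set C : ℝ := A * c * (1 - q)⁻¹ * P o * Real.exp (-((1 - α) * δ₀ * g.dist (oblk o) y')) * B with hC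
  have hM : ∀ M : ℕ, N o (G' μ) ≤ C + E * B * q ^ M := by
    intro M
    have hS := hpartial M y' μ B hμ o
    have hsup : ∀ z, |(R ^ M) μ z| ≤ q ^ M * B := fun z => by
      have h1 := hRn M y' μ B hμ z
      rw [evalN_apply] at h1
      refine h1.trans (mul_le_mul_of_nonneg_right ?_ hB)
      have : Real.exp (-((1 - α) * δ₀ * g.dist (blk z) y')) ≤ 1 := by
        rw [Real.exp_le_one_iff]
        have := mul_nonneg hαδ (hdnn (blk z) y')
        linarith
      simpa using mul_le_mul_of_nonneg_left this (pow_nonneg hq0 M)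
    have hrem : N o ((G' * R ^ M) μ) ≤ E * (q ^ M * B) := by
      rw [Module.End.mul_apply]
      exact hEb _ _ (mul_nonneg (pow_nonneg hq0 M) hB) hsup
    have hsplit : G' μ = (∑ n ∈ Finset.range M, G0 * R ^ n) μ + (G' * R ^ M) μ := by
      conv_lhs => rw [fixedPoint_telescope hfix M]
      rfl
    rw [hsplit]
    refine (map_add_le_add (N o) _ _).trans ?_
    have h1 : N o ((∑ n ∈ Finset.range M, G0 * R ^ n) μ) ≤ C := by simpa [hC, hq] using hS
    nlinarith [hrem, h1]
  have hlim : Filter.Tendsto (fun M : ℕ => C + E * B * q ^ M) Filter.atTop (nhds (C + E * B * 0)) :=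
    ((tendsto_pow_atTop_nhds_zero_of_lt_one hq0 hsmall).const_mul (E * B)).const_add C
  rw [mul_zero, add_zero] at hlim
  have := ge_of_tendsto' hlim hM
  simpa [hC, hq] using this

/-! ## §2. Proposition 2.6, every entry, for an arbitrary (2.61)-constant -/

/-- **LEFT entries of (2.136)/(2.137)/(2.140) for sup sources, any output seminorm family, ANY constant `c ≥ 0`**
(pv01's `B6Prop26Norms.prop26_leftEntry_of_291` with c₁ ↦ c): (2.91) `Δ_aG₀ = I − R` with `GΔ_a = I` gives G = G₀ + GR,
then THEOREM A. [cite: Balaban1984PropagatorsII, Prop. 2.6 (2.136)–(2.137) p.247] -/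
theorem prop26_leftEntry_of_291W [Fintype X] [DecidableEq X] (blk : X → g.Site) (N : O → Seminorm ℝ (X → ℝ))
    (oblk : O → g.Site) (c δ α θ A : ℝ) (P : O → ℝ)
    (hA : 0 ≤ A) (hP : ∀ o, 0 ≤ P o) (hθ : 0 ≤ θ) (hc : 0 ≤ c) (hαδ : 0 ≤ (1 - α) * δ) (htri : Triangle254 g)
    (hrefl : ∀ y : g.Site, g.dist y y = 0) (hdnn : ∀ y y' : g.Site, 0 ≤ g.dist y y')
    (h261 : Ineq261With c g δ α) (h263 : Ineq263With c g δ α) (hsmall : θ * c < 1)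
    {G G0 R Δa : Module.End ℝ (X → ℝ)} (hinv : G * Δa = 1) (h291 : Δa * G0 = 1 - R)
    (hG0 : GMajorant (blockSrc blk) N G0 (fun o b => A * P o * Real.exp (-(δ * g.dist (oblk o) b))))
    (hR : HasMajorant blk R (fun a b => θ * Real.exp (-(δ * g.dist a b)))) :
    GMajorant (blockSrc blk) N G
      (fun o b => A * c * (1 - θ * c)⁻¹ * P o * Real.exp (-((1 - α) * δ * g.dist (oblk o) b))) :=
  gMajorant_of_fixedPointW blk N oblk c δ α θ A P hA hP hθ hc hαδ htri hrefl hdnn h261 h263 hsmall hG0 hR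
    (fixedPoint_of_291 hinv h291)

/-- **EVERY entry of (2.136)–(2.140), general sources S, output seminorms N, right factor E, ANY constant `c ≥ 0`**
(pv01's `B6Prop26Norms.prop26_ioEntry_of_291` with c₁ ↦ c): from (2.91) with `GΔ_a = I`; the (2.133)-type majorant
A·P_G(o)·e^{−δd} of G₀ (sup → N) and the (2.135)-majorant θe^{−δd} of R (THEOREM A ⇒ K_G with C_G = A·c·(1 − θc)⁻¹, rate
(1−α)δ); the n = 0 input A₀·P(o)·e^{−δd} of G₀E (S → N); the located input θ₂·Q(y)·e^{−δd} of RE (S → sup); one scale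
transfer P_G(o)Q(y″) ≤ Λe^{εd}P(o) and the (2.63)-type convolution `Conv263` at a rate δ₀ with δ₀ + ε ≤ (1−α)δ, δ₀ ≤ δ,
θ_c ≤ δ ⟹ GE takes S-sources to N-outputs with the printed shape O(1)·P(o)·e^{−θ_c d}, O(1) = A₀ + C_Gθ₂ΛC_c.
[cite: Balaban1984PropagatorsII, Prop. 2.6 (2.136)–(2.141) p.247] -/
theorem prop26_ioEntry_of_291W [Fintype X] [DecidableEq X] (blk : X → g.Site) (S : SourceClass g X)
    (N : O → Seminorm ℝ (X → ℝ)) (oblk : O → g.Site) (c δ α θ A : ℝ) (PG : O → ℝ)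
    (A₀ θ₂ Λ ε δ₀ Cc θc : ℝ) (P : O → ℝ) (Q : g.Site → ℝ)
    (hA : 0 ≤ A) (hPG : ∀ o, 0 ≤ PG o) (hθ : 0 ≤ θ) (hc : 0 ≤ c) (hαδ : 0 ≤ (1 - α) * δ) (htri : Triangle254 g)
    (hrefl : ∀ y : g.Site, g.dist y y = 0) (hdnn : ∀ y y' : g.Site, 0 ≤ g.dist y y')
    (h261 : Ineq261With c g δ α) (h263 : Ineq263With c g δ α) (hsmall : θ * c < 1)
    (hA₀ : 0 ≤ A₀) (hθ₂ : 0 ≤ θ₂) (hΛ : 0 ≤ Λ) (hP : ∀ o, 0 ≤ P o) (hQ : ∀ y, 0 ≤ Q y)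
    (htransfer : ∀ o y'', PG o * Q y'' ≤ Λ * Real.exp (ε * g.dist (oblk o) y'') * P o)
    (hδb : δ₀ + ε ≤ (1 - α) * δ) (hδc : δ₀ ≤ δ) (hθc : θc ≤ δ) (hConv : B6Cor28.Conv263 g.dist δ₀ Cc θc)
    {G G0 R Δa : Module.End ℝ (X → ℝ)} (E : Module.End ℝ (X → ℝ)) (hinv : G * Δa = 1)
    (h291 : Δa * G0 = 1 - R)
    (hG0 : GMajorant (blockSrc blk) N G0 (fun o b => A * PG o * Real.exp (-(δ * g.dist (oblk o) b))))
    (hR : HasMajorant blk R (fun a b => θ * Real.exp (-(δ * g.dist a b))))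
    (hG0E : GMajorant S N (G0 * E) (fun o b => A₀ * P o * Real.exp (-(δ * g.dist (oblk o) b))))
    (hRE : GMajorant S evalN (R * E) (fun x b => θ₂ * Q (blk x) * Real.exp (-(δ * g.dist (blk x) b)))) :
    GMajorant S N (G * E)
      (fun o b => (A₀ + A * c * (1 - θ * c)⁻¹ * θ₂ * Λ * Cc) * P o * Real.exp (-(θc * g.dist (oblk o) b))) := by
  have hfix : G = G0 + G * R := fixedPoint_of_291 hinv h291
  have hG := gMajorant_of_fixedPointW blk N oblk c δ α θ A PG hA hPG hθ hc hαδ htri hrefl hdnn h261 h263 hsmall hG0 hR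
    hfix
  have hCG : 0 ≤ A * c * (1 - θ * c)⁻¹ := mul_nonneg (mul_nonneg hA hc) (inv_nonneg.mpr (by linarith))
  have hB := gMajorant_rightFactor blk E hfix (fun a b => θ₂ * Q a * Real.exp (-(δ * g.dist a b))) hG hG0E hRE
    (fun a b => mul_nonneg (mul_nonneg hθ₂ (hQ a)) (Real.exp_nonneg _))
  refine gMajorant_mono hB fun o b => ?_
  have hk := rightFactor_kernel g.dist oblk P PG Q A₀ (A * c * (1 - θ * c)⁻¹) θ₂ Λ ε δ ((1 - α) * δ) δ δ₀ Cc θc hA₀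
    hCG hθ₂ hΛ hP hPG hQ hdnn htransfer hδb hδc hθc hConv o b
  refine le_trans (le_of_eq ?_) (le_trans hk (le_of_eq (by ring)))
  exact congrArg₂ (· + ·) rfl (Finset.sum_congr rfl fun y'' _ => by ring)

/-- **The entry |(G∇*J)(x)| ≤ O(1)L^jη e^{−δ₃d(y,y′)}|J| of (2.136), ANY constant `c ≥ 0`** (pv01's
`B6Prop26Norms.prop26_entry3_of_291` with c₁ ↦ c): P_G = (L^jη)², P = L^jη, Q = (L^jη)⁻¹ and the transfer from
L^jη ≤ Λe^{εd(y,y″)}L^{j″}η. [cite: Balaban1984PropagatorsII, Prop. 2.6 (2.136) p.247] -/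
theorem prop26_entry3_of_291W [Fintype X] [DecidableEq X] (blk : X → g.Site) (c δ α θ A : ℝ)
    (A₀ θ₂ Λ ε δ₀ Cc θc : ℝ)
    (hA : 0 ≤ A) (hθ : 0 ≤ θ) (hc : 0 ≤ c) (hαδ : 0 ≤ (1 - α) * δ) (htri : Triangle254 g)
    (hrefl : ∀ y : g.Site, g.dist y y = 0) (hdnn : ∀ y y' : g.Site, 0 ≤ g.dist y y')
    (h261 : Ineq261With c g δ α) (h263 : Ineq263With c g δ α) (hsmall : θ * c < 1)
    (hA₀ : 0 ≤ A₀) (hθ₂ : 0 ≤ θ₂) (hΛ : 0 ≤ Λ) (hL : 1 ≤ g.L) (hη : 0 < g.eta)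
    (htransfer : ∀ a b : g.Site, g.len a ≤ Λ * Real.exp (ε * g.dist a b) * g.len b)
    (hδb : δ₀ + ε ≤ (1 - α) * δ) (hδc : δ₀ ≤ δ) (hθc : θc ≤ δ) (hConv : B6Cor28.Conv263 g.dist δ₀ Cc θc)
    {G G0 R Δa : Module.End ℝ (X → ℝ)} (E : Module.End ℝ (X → ℝ)) (hinv : G * Δa = 1)
    (h291 : Δa * G0 = 1 - R)
    (hG0 : HasMajorant blk G0 (fun a b => A * g.len a ^ 2 * Real.exp (-(δ * g.dist a b))))
    (hR : HasMajorant blk R (fun a b => θ * Real.exp (-(δ * g.dist a b))))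
    (hG0E : HasMajorant blk (G0 * E) (fun a b => A₀ * g.len a * Real.exp (-(δ * g.dist a b))))
    (hRE : HasMajorant blk (R * E) (fun a b => θ₂ * (g.len a)⁻¹ * Real.exp (-(δ * g.dist a b)))) :
    HasMajorant blk (G * E)
      (fun a b => (A₀ + A * c * (1 - θ * c)⁻¹ * θ₂ * Λ * Cc) * g.len a * Real.exp (-(θc * g.dist a b))) := by
  have hlen : ∀ y : g.Site, 0 < g.len y := B6Cor28.len_pos g hL hη
  rw [hasMajorant_iff]
  exact prop26_ioEntry_of_291W blk (blockSrc blk) evalN blk c δ α θ A (fun x => g.len (blk x) ^ 2) A₀ θ₂ Λ ε δ₀ Cc θc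
    (fun x => g.len (blk x)) (fun y => (g.len y)⁻¹) hA (fun x => pow_nonneg (hlen _).le 2) hθ hc hαδ htri hrefl hdnn
    h261 h263 hsmall hA₀ hθ₂ hΛ (fun x => (hlen _).le) (fun y => inv_nonneg.mpr (hlen y).le)
    (fun x y'' => len_transfer_sq_inv g.len Λ ε hlen htransfer (blk x) y'') hδb hδc hθc hConv E hinv h291
    ((hasMajorant_iff blk G0 _).mp hG0) hR ((hasMajorant_iff blk (G0 * E) _).mp hG0E)
    ((hasMajorant_iff blk (R * E) _).mp hRE)

/-- **EVERY entry with a right factor, commutator arrangement, TWO arbitrary constants** `c` ((2.61)/(2.63) at the rate δ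
of the majorants) and `cs` ((2.61)/(2.63) at the rate θ_c, for THEOREM A applied to X = GE) — pv01's
`B6Prop26Norms.prop26_ioEntry_comm_of_291` with c₁(d,δ,α) ↦ c, c₁(d,θ_c,α♯) ↦ cs.
[cite: Balaban1984PropagatorsII, Prop. 2.6 (2.136)–(2.141) p.247; (2.92) p.239] -/
theorem prop26_ioEntry_comm_of_291W [Fintype X] [DecidableEq X] (blk : X → g.Site) (N : O → Seminorm ℝ (X → ℝ))
    (oblk : O → g.Site) (c δ α θ A : ℝ) (PG : O → ℝ) (A₀ θf Λ ε δ₀ Cc θc : ℝ) (P : O → ℝ)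
    (Q : g.Site → ℝ) (cs αs θs : ℝ)
    (hA : 0 ≤ A) (hPG : ∀ o, 0 ≤ PG o) (hθ : 0 ≤ θ) (hc : 0 ≤ c) (hαδ : 0 ≤ (1 - α) * δ) (htri : Triangle254 g)
    (hrefl : ∀ y : g.Site, g.dist y y = 0) (hdnn : ∀ y y' : g.Site, 0 ≤ g.dist y y')
    (h261 : Ineq261With c g δ α) (h263 : Ineq263With c g δ α) (hsmall : θ * c < 1)
    (hA₀ : 0 ≤ A₀) (hθf : 0 ≤ θf) (hΛ : 0 ≤ Λ) (hP : ∀ o, 0 ≤ P o) (hQ : ∀ y, 0 ≤ Q y)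
    (htransfer : ∀ o y'', PG o * Q y'' ≤ Λ * Real.exp (ε * g.dist (oblk o) y'') * P o)
    (hδb : δ₀ + ε ≤ (1 - α) * δ) (hδc : δ₀ ≤ δ) (hθc : θc ≤ δ) (hConv : B6Cor28.Conv263 g.dist δ₀ Cc θc)
    (hCc : 0 ≤ Cc) (hθs : 0 ≤ θs) (hcs : 0 ≤ cs) (hαθc : 0 ≤ (1 - αs) * θc) (h261c : Ineq261With cs g θc αs)
    (h263c : Ineq263With cs g θc αs) (hsmalls : θs * cs < 1)
    {G G0 R Δa Rs Rf : Module.End ℝ (X → ℝ)} (E : Module.End ℝ (X → ℝ)) (hinv : G * Δa = 1)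
    (h291 : Δa * G0 = 1 - R) (hdec : R * E = E * Rs + Rf)
    (hG0 : GMajorant (blockSrc blk) N G0 (fun o b => A * PG o * Real.exp (-(δ * g.dist (oblk o) b))))
    (hR : HasMajorant blk R (fun a b => θ * Real.exp (-(δ * g.dist a b))))
    (hG0E : GMajorant (blockSrc blk) N (G0 * E) (fun o b => A₀ * P o * Real.exp (-(δ * g.dist (oblk o) b))))
    (hRf : HasMajorant blk Rf (fun a b => θf * Q a * Real.exp (-(δ * g.dist a b))))
    (hRs : HasMajorant blk Rs (fun a b => θs * Real.exp (-(θc * g.dist a b)))) :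
    GMajorant (blockSrc blk) N (G * E)
      (fun o b => (A₀ + A * c * (1 - θ * c)⁻¹ * θf * Λ * Cc) * cs * (1 - θs * cs)⁻¹ * P o *
        Real.exp (-((1 - αs) * θc * g.dist (oblk o) b))) := by
  have hfix : G = G0 + G * R := fixedPoint_of_291 hinv h291
  have hG := gMajorant_of_fixedPointW blk N oblk c δ α θ A PG hA hPG hθ hc hαδ htri hrefl hdnn h261 h263 hsmall hG0 hR
    hfix
  have hCG : 0 ≤ A * c * (1 - θ * c)⁻¹ := mul_nonneg (mul_nonneg hA hc) (inv_nonneg.mpr (by linarith))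
  have hRf' : GMajorant (blockSrc blk) evalN Rf
      (fun x => (fun a b => θf * Q a * Real.exp (-(δ * g.dist a b))) (blk x)) :=
    (hasMajorant_iff blk Rf _).mp hRf
  have hB₀ := gMajorant_add hG0E (gMajorant_mul blk (K₂ := fun a b => θf * Q a * Real.exp (-(δ * g.dist a b)))
    hG hRf' (fun a b => mul_nonneg (mul_nonneg hθf (hQ a)) (Real.exp_nonneg _)))
  have hB : GMajorant (blockSrc blk) N (G0 * E + G * Rf)
      (fun o b => (A₀ + A * c * (1 - θ * c)⁻¹ * θf * Λ * Cc) * P o * Real.exp (-(θc * g.dist (oblk o) b))) := by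
    refine gMajorant_mono hB₀ fun o b => ?_
    have hk := rightFactor_kernel g.dist oblk P PG Q A₀ (A * c * (1 - θ * c)⁻¹) θf Λ ε δ ((1 - α) * δ) δ δ₀ Cc θc
      hA₀ hCG hθf hΛ hP hPG hQ hdnn htransfer hδb hδc hθc hConv o b
    refine le_trans (le_of_eq ?_) hk
    exact congrArg₂ (· + ·) rfl (Finset.sum_congr rfl fun y'' _ => by ring)
  have hBnn : 0 ≤ A₀ + A * c * (1 - θ * c)⁻¹ * θf * Λ * Cc :=
    add_nonneg hA₀ (mul_nonneg (mul_nonneg (mul_nonneg hCG hθf) hΛ) hCc)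
  exact gMajorant_of_fixedPointW blk N oblk cs θc αs θs _ P hBnn hP hθs hcs hαθc htri hrefl hdnn h261c h263c hsmalls
    hB hRs (rightFactor_fixedPoint_comm E hfix hdec)

/-- **The entry |(G∇*J)(x)| by the commutator arrangement, TWO arbitrary constants** (pv01's
`B6Prop26Norms.prop26_entry3_comm_of_291` with c₁(d,δ,α) ↦ c, c₁(d,θ_c,α♯) ↦ cs).
[cite: Balaban1984PropagatorsII, Prop. 2.6 (2.136)₃/(2.141) p.247; (2.92) p.239] -/
theorem prop26_entry3_comm_of_291W [Fintype X] [DecidableEq X] (blk : X → g.Site) (c δ α θ A : ℝ)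
    (A₀ θf Λ ε δ₀ Cc θc cs αs θs : ℝ)
    (hA : 0 ≤ A) (hθ : 0 ≤ θ) (hc : 0 ≤ c) (hαδ : 0 ≤ (1 - α) * δ) (htri : Triangle254 g)
    (hrefl : ∀ y : g.Site, g.dist y y = 0) (hdnn : ∀ y y' : g.Site, 0 ≤ g.dist y y')
    (h261 : Ineq261With c g δ α) (h263 : Ineq263With c g δ α) (hsmall : θ * c < 1)
    (hA₀ : 0 ≤ A₀) (hθf : 0 ≤ θf) (hΛ : 0 ≤ Λ) (hL : 1 ≤ g.L) (hη : 0 < g.eta)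
    (htransfer : ∀ a b : g.Site, g.len a ≤ Λ * Real.exp (ε * g.dist a b) * g.len b)
    (hδb : δ₀ + ε ≤ (1 - α) * δ) (hδc : δ₀ ≤ δ) (hθc : θc ≤ δ) (hConv : B6Cor28.Conv263 g.dist δ₀ Cc θc)
    (hCc : 0 ≤ Cc) (hθs : 0 ≤ θs) (hcs : 0 ≤ cs) (hαθc : 0 ≤ (1 - αs) * θc) (h261c : Ineq261With cs g θc αs)
    (h263c : Ineq263With cs g θc αs) (hsmalls : θs * cs < 1)
    {G G0 R Δa Rs Rf : Module.End ℝ (X → ℝ)} (E : Module.End ℝ (X → ℝ)) (hinv : G * Δa = 1)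
    (h291 : Δa * G0 = 1 - R) (hdec : R * E = E * Rs + Rf)
    (hG0 : HasMajorant blk G0 (fun a b => A * g.len a ^ 2 * Real.exp (-(δ * g.dist a b))))
    (hR : HasMajorant blk R (fun a b => θ * Real.exp (-(δ * g.dist a b))))
    (hG0E : HasMajorant blk (G0 * E) (fun a b => A₀ * g.len a * Real.exp (-(δ * g.dist a b))))
    (hRf : HasMajorant blk Rf (fun a b => θf * (g.len a)⁻¹ * Real.exp (-(δ * g.dist a b))))
    (hRs : HasMajorant blk Rs (fun a b => θs * Real.exp (-(θc * g.dist a b)))) :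
    HasMajorant blk (G * E)
      (fun a b => (A₀ + A * c * (1 - θ * c)⁻¹ * θf * Λ * Cc) * cs * (1 - θs * cs)⁻¹ * g.len a *
        Real.exp (-((1 - αs) * θc * g.dist a b))) := by
  have hlen : ∀ y : g.Site, 0 < g.len y := B6Cor28.len_pos g hL hη
  rw [hasMajorant_iff]
  exact prop26_ioEntry_comm_of_291W blk evalN blk c δ α θ A (fun x => g.len (blk x) ^ 2) A₀ θf Λ ε δ₀ Cc θc
    (fun x => g.len (blk x)) (fun y => (g.len y)⁻¹) cs αs θs hA (fun x => pow_nonneg (hlen _).le 2) hθ hc hαδ htri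
    hrefl hdnn h261 h263 hsmall hA₀ hθf hΛ (fun x => (hlen _).le) (fun y => inv_nonneg.mpr (hlen y).le)
    (fun x y'' => len_transfer_sq_inv g.len Λ ε hlen htransfer (blk x) y'') hδb hδc hθc hConv hCc hθs hcs hαθc h261c
    h263c hsmalls E hinv h291 hdec ((hasMajorant_iff blk G0 _).mp hG0) hR
    ((hasMajorant_iff blk (G0 * E) _).mp hG0E) hRf hRs

end General

/-! ## §3. Bound to the REPAIRED Lemma 2.1′ of the tree (`B6Lemma21Repaired.Lemma21Repaired`) -/

section Repaired

variable {I : Type}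

/-- **EVERY entry, with the REPAIRED Lemma 2.1′ of the tree at two rates** (pv01's `B6Prop26Norms.prop26_ioEntry_of_lemma21`
with `B6.Lemma21Printed` ↦ `B6Lemma21Repaired.Lemma21Repaired`, c₁ ↦ c₁′ = 13c₀(½α)^{3d} at each rate): for a geometry of
a family satisfying the repaired Lemma at the rate δ of the majorants (parameter α) AND at a second rate r (parameter α′),
under (2.1)–(2.2), (2.59) at both pairs, (2.54), d(y,y) = 0, d ≥ 0 and the rate budget r + ε ≤ (1−α)δ, the hypotheses
(2.61′)/(2.63′)/`Conv263` of `prop26_ioEntry_of_291W` are DISCHARGED (`B6Lemma21Repaired.ineq263With_of_261With`,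
`B6Prop26ChainGeneric.conv263_of_ineq263With`); the scale transfer stays a hypothesis (entry-specific).  Final rate
(1−α′)r, O(1) = A₀ + A·c₁′(d,δ,α)(1 − θc₁′(d,δ,α))⁻¹θ₂Λ·c₁′(d,r,α′)².
[cite: Balaban1984PropagatorsII, Prop. 2.6 p.247; Lemma 2.1 p.234; repaired] -/
theorem prop26_ioEntry_of_lemma21Repaired (d : ℕ) (δ r : ℝ) (hδ : 0 ≤ δ) (hr : 0 ≤ r) (geo : I → B6.Geometry)
    (h21 : Lemma21Repaired d δ geo) (h21r : Lemma21Repaired d r geo) (i : I) (htri : Triangle254 (geo i))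
    (hrefl : ∀ y : (geo i).Site, (geo i).dist y y = 0) (hdnn : ∀ y y' : (geo i).Site, 0 ≤ (geo i).dist y y')
    (hH : (geo i).Hyp21_22) (α α' : ℝ) (hα0 : 0 < α) (hα1 : α < 1) (hα'0 : 0 < α') (hα'1 : α' < 1)
    (h259 : B6.Cond259 d δ α (geo i).R (geo i).M) (h259r : B6.Cond259 d r α' (geo i).R (geo i).M)
    (ε : ℝ) (hε : 0 ≤ ε) (hrate : r + ε ≤ (1 - α) * δ)
    {X O : Type} [Fintype X] [DecidableEq X] (blk : X → (geo i).Site) (S : SourceClass (geo i) X)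
    (N : O → Seminorm ℝ (X → ℝ)) (oblk : O → (geo i).Site) (θ A A₀ θ₂ Λ : ℝ) (PG P : O → ℝ)
    (Q : (geo i).Site → ℝ) (hA : 0 ≤ A) (hPG : ∀ o, 0 ≤ PG o) (hθ : 0 ≤ θ) (hA₀ : 0 ≤ A₀) (hθ₂ : 0 ≤ θ₂)
    (hΛ : 0 ≤ Λ) (hP : ∀ o, 0 ≤ P o) (hQ : ∀ y, 0 ≤ Q y) (hsmall : θ * B6Lemma21Arith.c1Repaired d δ α < 1)
    (htransfer : ∀ o y'', PG o * Q y'' ≤ Λ * Real.exp (ε * (geo i).dist (oblk o) y'') * P o)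
    {G G0 R Δa : Module.End ℝ (X → ℝ)} (E : Module.End ℝ (X → ℝ)) (hinv : G * Δa = 1)
    (h291 : Δa * G0 = 1 - R)
    (hG0 : GMajorant (blockSrc blk) N G0 (fun o b => A * PG o * Real.exp (-(δ * (geo i).dist (oblk o) b))))
    (hR : HasMajorant blk R (fun a b => θ * Real.exp (-(δ * (geo i).dist a b))))
    (hG0E : GMajorant S N (G0 * E) (fun o b => A₀ * P o * Real.exp (-(δ * (geo i).dist (oblk o) b))))
    (hRE : GMajorant S evalN (R * E)
      (fun x b => θ₂ * Q (blk x) * Real.exp (-(δ * (geo i).dist (blk x) b)))) :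
    GMajorant S N (G * E)
      (fun o b => (A₀ + A * B6Lemma21Arith.c1Repaired d δ α * (1 - θ * B6Lemma21Arith.c1Repaired d δ α)⁻¹ * θ₂ * Λ *
          B6Lemma21Arith.c1Repaired d r α' ^ 2) * P o *
        Real.exp (-((1 - α') * r * (geo i).dist (oblk o) b))) := by
  have h261 : Ineq261With (B6Lemma21Arith.c1Repaired d δ α) (geo i) δ α := (h21 i hH α hα0 hα1 h259).2
  have h263 : Ineq263With (B6Lemma21Arith.c1Repaired d δ α) (geo i) δ α := ineq263With_of_261With htri hδ hα1.le h261
  have h261r : Ineq261With (B6Lemma21Arith.c1Repaired d r α') (geo i) r α' := (h21r i hH α' hα'0 hα'1 h259r).2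
  have h263r : Ineq263With (B6Lemma21Arith.c1Repaired d r α') (geo i) r α' :=
    ineq263With_of_261With htri hr hα'1.le h261r
  have hConv := B6Prop26ChainGeneric.conv263_of_ineq263With (B6Lemma21Arith.c1Repaired d r α') (geo i) r α' h263r
  have hαδ : 0 ≤ (1 - α) * δ := mul_nonneg (by linarith) hδ
  have hδc : r ≤ δ := by nlinarith
  have hθc : (1 - α') * r ≤ δ := by nlinarith
  exact prop26_ioEntry_of_291W blk S N oblk _ δ α θ A PG A₀ θ₂ Λ ε r (B6Lemma21Arith.c1Repaired d r α' ^ 2)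
    ((1 - α') * r) P Q hA hPG hθ (c1Repaired_nonneg d δ α) hαδ htri hrefl hdnn h261 h263 hsmall hA₀ hθ₂ hΛ hP hQ
    htransfer hrate hδc hθc hConv E hinv h291 hG0 hR hG0E hRE

/-- **|(G∇*J)(x)| ≤ O(1)L^jη e^{−δ₃d(y,y′)}|J| with the REPAIRED Lemma 2.1′ of the tree at two rates** (pv01's
`B6Prop26Norms.prop26_entry3_of_lemma21` with `B6.Lemma21Printed` ↦ `Lemma21Repaired`): (2.61′)/(2.63′) at rate δ, (2.63′)
at rate r and the scale transfer L^jη ≤ L·e^{α′rd(y,y″)}·L^{j″}η from (2.60) at rate α′r (`B6Cor28.transfer_of_260`,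
q = 1, under L ≤ e^{α′rRM}) DISCHARGED; delivered δ₃ = (1−α′)r and
O(1) = A₀ + A·c₁′(d,δ,α)(1 − θc₁′(d,δ,α))⁻¹θ₂·L·c₁′(d,r,α′)².
[cite: Balaban1984PropagatorsII, Prop. 2.6 (2.136) p.247; Lemma 2.1 (2.60)–(2.63) p.234; repaired] -/
theorem prop26_entry3_of_lemma21Repaired (d : ℕ) (δ r : ℝ) (hδ : 0 ≤ δ) (hr : 0 ≤ r) (geo : I → B6.Geometry)
    (h21 : Lemma21Repaired d δ geo) (h21r : Lemma21Repaired d r geo) (i : I) (htri : Triangle254 (geo i))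
    (hrefl : ∀ y : (geo i).Site, (geo i).dist y y = 0) (hdnn : ∀ y y' : (geo i).Site, 0 ≤ (geo i).dist y y')
    (hH : (geo i).Hyp21_22) (α α' : ℝ) (hα0 : 0 < α) (hα1 : α < 1) (hα'0 : 0 < α') (hα'1 : α' < 1)
    (h259 : B6.Cond259 d δ α (geo i).R (geo i).M) (h259r : B6.Cond259 d r α' (geo i).R (geo i).M)
    (hL : 1 ≤ (geo i).L) (hη : 0 < (geo i).eta) (hlarge : (geo i).L ≤ Real.exp (α' * r * (geo i).R * (geo i).M))
    (hrate : r + α' * r ≤ (1 - α) * δ)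
    {X : Type} [Fintype X] [DecidableEq X] (blk : X → (geo i).Site) (θ A A₀ θ₂ : ℝ)
    (hA : 0 ≤ A) (hθ : 0 ≤ θ) (hA₀ : 0 ≤ A₀) (hθ₂ : 0 ≤ θ₂) (hsmall : θ * B6Lemma21Arith.c1Repaired d δ α < 1)
    {G G0 R Δa : Module.End ℝ (X → ℝ)} (E : Module.End ℝ (X → ℝ)) (hinv : G * Δa = 1)
    (h291 : Δa * G0 = 1 - R)
    (hG0 : HasMajorant blk G0 (fun a b => A * (geo i).len a ^ 2 * Real.exp (-(δ * (geo i).dist a b))))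
    (hR : HasMajorant blk R (fun a b => θ * Real.exp (-(δ * (geo i).dist a b))))
    (hG0E : HasMajorant blk (G0 * E) (fun a b => A₀ * (geo i).len a * Real.exp (-(δ * (geo i).dist a b))))
    (hRE : HasMajorant blk (R * E)
      (fun a b => θ₂ * ((geo i).len a)⁻¹ * Real.exp (-(δ * (geo i).dist a b)))) :
    HasMajorant blk (G * E)
      (fun a b => (A₀ + A * B6Lemma21Arith.c1Repaired d δ α * (1 - θ * B6Lemma21Arith.c1Repaired d δ α)⁻¹ * θ₂ *
          (geo i).L * B6Lemma21Arith.c1Repaired d r α' ^ 2) * (geo i).len a *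
        Real.exp (-((1 - α') * r * (geo i).dist a b))) := by
  have h261 : Ineq261With (B6Lemma21Arith.c1Repaired d δ α) (geo i) δ α := (h21 i hH α hα0 hα1 h259).2
  have h263 : Ineq263With (B6Lemma21Arith.c1Repaired d δ α) (geo i) δ α := ineq263With_of_261With htri hδ hα1.le h261
  obtain ⟨h260r, h261r⟩ := h21r i hH α' hα'0 hα'1 h259r
  have h263r : Ineq263With (B6Lemma21Arith.c1Repaired d r α') (geo i) r α' :=
    ineq263With_of_261With htri hr hα'1.le h261r
  have hConv := B6Prop26ChainGeneric.conv263_of_ineq263With (B6Lemma21Arith.c1Repaired d r α') (geo i) r α' h263r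
  have hαδ : 0 ≤ (1 - α) * δ := mul_nonneg (by linarith) hδ
  have hδc : r ≤ δ := by nlinarith
  have hθc : (1 - α') * r ≤ δ := by nlinarith
  have e1 : |(1 : ℝ)| = 1 := abs_one
  have hl1 : (geo i).L ^ |(1 : ℝ)| ≤ Real.exp (α' * r * (geo i).R * (geo i).M) := by
    rw [e1, Real.rpow_one]; exact hlarge
  have hT := (B6Cor28.transfer_of_260 (geo i).scale (geo i).dist (geo i).L (geo i).eta (α' * r) (geo i).R
    (geo i).M (1 : ℝ) hL hη hl1 h260r).1
  rw [e1, ← B6Cor28.len_eq_rpow] at hT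
  have htransfer : ∀ a b : (geo i).Site,
      (geo i).len a ≤ (geo i).L * Real.exp (α' * r * (geo i).dist a b) * (geo i).len b := by
    intro a b
    have h := hT a b
    simp only [Real.rpow_one] at h
    exact h
  exact prop26_entry3_of_291W blk _ δ α θ A A₀ θ₂ (geo i).L (α' * r) r (B6Lemma21Arith.c1Repaired d r α' ^ 2)
    ((1 - α') * r) hA hθ (c1Repaired_nonneg d δ α) hαδ htri hrefl hdnn h261 h263 hsmall hA₀ hθ₂
    (le_trans zero_le_one hL) hL hη htransfer hrate hδc hθc hConv E hinv h291 hG0 hR hG0E hRE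

/-- **The whole printed table (2.136) at once, with the REPAIRED Lemma 2.1′ of the tree** (pv01's
`B6Prop26Norms.prop26_table2136_of_lemma21` with `B6.Lemma21Printed` ↦ `Lemma21Repaired`): |(GJ)(x)|, |(∇GJ)(x)|,
|(G∇*J)(x)|, |(ΔGJ)(x)| ≤ O(1)[(L^jη)², L^jη, L^jη, 1]e^{−δ₃d(y,y′)}|J| (`B6.pref4`) for sup sources — the left entries
n ≠ 2 from `B6Prop26ChainGeneric.prop26_three_entries_of_lemma21Repaired`, the right entry n = 2 from
`prop26_entry3_of_lemma21Repaired`, both weakened to the common rate δ₃ = (1−α′)r ≤ (1−α)δ and the common constant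
O(1) = A₀ + A·c₁′(1 − θc₁′)⁻¹(1 + θ₂·L·c₁′(d,r,α′)²). [cite: Balaban1984PropagatorsII, Prop. 2.6 (2.136) p.247; repaired] -/
theorem prop26_table2136_of_lemma21Repaired (d : ℕ) (δ r : ℝ) (hδ : 0 ≤ δ) (hr : 0 ≤ r)
    (geo : I → B6.Geometry) (h21 : Lemma21Repaired d δ geo) (h21r : Lemma21Repaired d r geo) (i : I)
    (htri : Triangle254 (geo i)) (hrefl : ∀ y : (geo i).Site, (geo i).dist y y = 0)
    (hdnn : ∀ y y' : (geo i).Site, 0 ≤ (geo i).dist y y') (hH : (geo i).Hyp21_22) (α α' : ℝ) (hα0 : 0 < α)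
    (hα1 : α < 1) (hα'0 : 0 < α') (hα'1 : α' < 1) (h259 : B6.Cond259 d δ α (geo i).R (geo i).M)
    (h259r : B6.Cond259 d r α' (geo i).R (geo i).M) (hL : 1 ≤ (geo i).L) (hη : 0 < (geo i).eta)
    (hlarge : (geo i).L ≤ Real.exp (α' * r * (geo i).R * (geo i).M)) (hrate : r + α' * r ≤ (1 - α) * δ)
    {X : Type} [Fintype X] [DecidableEq X] (blk : X → (geo i).Site) (θ A A₀ θ₂ : ℝ)
    (hA : 0 ≤ A) (hθ : 0 ≤ θ) (hA₀ : 0 ≤ A₀) (hθ₂ : 0 ≤ θ₂) (hsmall : θ * B6Lemma21Arith.c1Repaired d δ α < 1)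
    {G G0 R Δa : Module.End ℝ (X → ℝ)} (D : Fin 4 → Module.End ℝ (X → ℝ)) (hD0 : D 0 = 1)
    (E : Module.End ℝ (X → ℝ)) (hinv : G * Δa = 1) (h291 : Δa * G0 = 1 - R)
    (hDG0 : ∀ n : Fin 4, n ≠ 2 → HasMajorant blk (D n * G0)
      (fun a b => A * B6.pref4 ((geo i).len a) n * Real.exp (-(δ * (geo i).dist a b))))
    (hR : HasMajorant blk R (fun a b => θ * Real.exp (-(δ * (geo i).dist a b))))
    (hG0E : HasMajorant blk (G0 * E) (fun a b => A₀ * (geo i).len a * Real.exp (-(δ * (geo i).dist a b))))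
    (hRE : HasMajorant blk (R * E)
      (fun a b => θ₂ * ((geo i).len a)⁻¹ * Real.exp (-(δ * (geo i).dist a b)))) :
    (∀ n : Fin 4, n ≠ 2 → HasMajorant blk (D n * G)
      (fun a b => (A₀ + A * B6Lemma21Arith.c1Repaired d δ α * (1 - θ * B6Lemma21Arith.c1Repaired d δ α)⁻¹ *
          (1 + θ₂ * (geo i).L * B6Lemma21Arith.c1Repaired d r α' ^ 2)) * B6.pref4 ((geo i).len a) n *
        Real.exp (-((1 - α') * r * (geo i).dist a b)))) ∧
    HasMajorant blk (G * E)
      (fun a b => (A₀ + A * B6Lemma21Arith.c1Repaired d δ α * (1 - θ * B6Lemma21Arith.c1Repaired d δ α)⁻¹ *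
          (1 + θ₂ * (geo i).L * B6Lemma21Arith.c1Repaired d r α' ^ 2)) * B6.pref4 ((geo i).len a) 2 *
        Real.exp (-((1 - α') * r * (geo i).dist a b))) := by
  have hlen : ∀ y : (geo i).Site, 0 < (geo i).len y := B6Cor28.len_pos (geo i) hL hη
  have hpref : ∀ (n : Fin 4) (y : (geo i).Site), 0 ≤ B6.pref4 ((geo i).len y) n := by
    intro n y
    have h := (hlen y).le
    fin_cases n <;> simp [B6.pref4] <;> positivity
  have hc0 : 0 ≤ B6Lemma21Arith.c1Repaired d δ α := c1Repaired_nonneg d δ α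
  have hC₁ : 0 ≤ A * B6Lemma21Arith.c1Repaired d δ α * (1 - θ * B6Lemma21Arith.c1Repaired d δ α)⁻¹ :=
    mul_nonneg (mul_nonneg hA hc0) (inv_nonneg.mpr (by linarith))
  have hextra : 0 ≤ θ₂ * (geo i).L * B6Lemma21Arith.c1Repaired d r α' ^ 2 :=
    mul_nonneg (mul_nonneg hθ₂ (le_trans zero_le_one hL)) (pow_nonneg (c1Repaired_nonneg d r α') 2)
  have hrates : (1 - α') * r ≤ (1 - α) * δ := by nlinarith
  have hleft := (B6Prop26ChainGeneric.prop26_three_entries_of_lemma21Repaired d δ hδ geo h21 i htri hrefl hdnn hH α hα0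
    hα1 h259 hL hη blk θ A hA hθ hsmall D hD0 hinv h291 hDG0 hR).2
  have hright := prop26_entry3_of_lemma21Repaired d δ r hδ hr geo h21 h21r i htri hrefl hdnn hH α α' hα0 hα1 hα'0 hα'1
    h259 h259r hL hη hlarge hrate blk θ A A₀ θ₂ hA hθ hA₀ hθ₂ hsmall E hinv h291
    (by simpa [B6.pref4, hD0] using hDG0 0) hR hG0E hRE
  refine ⟨fun n hn => hasMajorant_mono blk (hleft n hn) fun a b => ?_, hasMajorant_mono blk hright fun a b => ?_⟩
  · have hw := B6Cor28.exp_weaken_le ((1 - α) * δ) ((1 - α') * r) ((geo i).dist a b) hrates (hdnn a b)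
    have hc : A * B6Lemma21Arith.c1Repaired d δ α * (1 - θ * B6Lemma21Arith.c1Repaired d δ α)⁻¹ ≤
        A₀ + A * B6Lemma21Arith.c1Repaired d δ α * (1 - θ * B6Lemma21Arith.c1Repaired d δ α)⁻¹ *
          (1 + θ₂ * (geo i).L * B6Lemma21Arith.c1Repaired d r α' ^ 2) := by nlinarith
    calc A * B6Lemma21Arith.c1Repaired d δ α * (1 - θ * B6Lemma21Arith.c1Repaired d δ α)⁻¹ *
          B6.pref4 ((geo i).len a) n * Real.exp (-((1 - α) * δ * (geo i).dist a b))
        ≤ A * B6Lemma21Arith.c1Repaired d δ α * (1 - θ * B6Lemma21Arith.c1Repaired d δ α)⁻¹ *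
          B6.pref4 ((geo i).len a) n * Real.exp (-((1 - α') * r * (geo i).dist a b)) :=
          mul_le_mul_of_nonneg_left hw (mul_nonneg hC₁ (hpref n a))
      _ ≤ _ := mul_le_mul_of_nonneg_right (mul_le_mul_of_nonneg_right hc (hpref n a)) (Real.exp_nonneg _)
  · have h2 : B6.pref4 ((geo i).len a) 2 = (geo i).len a := by simp [B6.pref4]
    rw [h2]
    have hc : A₀ + A * B6Lemma21Arith.c1Repaired d δ α * (1 - θ * B6Lemma21Arith.c1Repaired d δ α)⁻¹ * θ₂ *
          (geo i).L * B6Lemma21Arith.c1Repaired d r α' ^ 2 ≤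
        A₀ + A * B6Lemma21Arith.c1Repaired d δ α * (1 - θ * B6Lemma21Arith.c1Repaired d δ α)⁻¹ *
          (1 + θ₂ * (geo i).L * B6Lemma21Arith.c1Repaired d r α' ^ 2) := by nlinarith
    exact mul_le_mul_of_nonneg_right (mul_le_mul_of_nonneg_right hc (hlen a).le) (Real.exp_nonneg _)

/-- **The entry |(G∇*J)(x)| by the commutator arrangement, with the REPAIRED Lemma 2.1′ of the tree at three rates**
(pv01's `B6Prop26Norms.prop26_entry3_comm_of_lemma21` with `B6.Lemma21Printed` ↦ `Lemma21Repaired`): rates δ (parameter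
α), r (parameter α′; transfer from (2.60) with q = 1 under L ≤ e^{α′rRM}, and the (2.63′)-convolution) and (1−α′)r
(parameter α♯), under (2.1)–(2.2), (2.59) thrice, (2.54), d(y,y) = 0, d ≥ 0, 1 ≤ L, 0 < η and r + α′r ≤ (1−α)δ.  Final rate
(1−α♯)(1−α′)r; O(1) = (A₀ + A·c₁′(d,δ,α)(1 − θc₁′(d,δ,α))⁻¹θ♭·L·c₁′(d,r,α′)²)·c₁′(d,(1−α′)r,α♯)·
(1 − θ♯c₁′(d,(1−α′)r,α♯))⁻¹. [cite: Balaban1984PropagatorsII, Prop. 2.6 (2.136)₃/(2.141) p.247; Lemma 2.1 p.234; (2.92) p.239; repaired] -/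
theorem prop26_entry3_comm_of_lemma21Repaired (d : ℕ) (δ r : ℝ) (hδ : 0 ≤ δ) (hr : 0 ≤ r)
    (geo : I → B6.Geometry) (α α' αs : ℝ) (h21 : Lemma21Repaired d δ geo) (h21r : Lemma21Repaired d r geo)
    (h21c : Lemma21Repaired d ((1 - α') * r) geo) (i : I) (htri : Triangle254 (geo i))
    (hrefl : ∀ y : (geo i).Site, (geo i).dist y y = 0) (hdnn : ∀ y y' : (geo i).Site, 0 ≤ (geo i).dist y y')
    (hH : (geo i).Hyp21_22) (hα0 : 0 < α) (hα1 : α < 1) (hα'0 : 0 < α') (hα'1 : α' < 1)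
    (hαs0 : 0 < αs) (hαs1 : αs < 1) (h259 : B6.Cond259 d δ α (geo i).R (geo i).M)
    (h259r : B6.Cond259 d r α' (geo i).R (geo i).M) (h259c : B6.Cond259 d ((1 - α') * r) αs (geo i).R (geo i).M)
    (hL : 1 ≤ (geo i).L) (hη : 0 < (geo i).eta) (hlarge : (geo i).L ≤ Real.exp (α' * r * (geo i).R * (geo i).M))
    (hrate : r + α' * r ≤ (1 - α) * δ)
    {X : Type} [Fintype X] [DecidableEq X] (blk : X → (geo i).Site) (θ A A₀ θf θs : ℝ)
    (hA : 0 ≤ A) (hθ : 0 ≤ θ) (hA₀ : 0 ≤ A₀) (hθf : 0 ≤ θf) (hθs : 0 ≤ θs)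
    (hsmall : θ * B6Lemma21Arith.c1Repaired d δ α < 1)
    (hsmalls : θs * B6Lemma21Arith.c1Repaired d ((1 - α') * r) αs < 1)
    {G G0 R Δa Rs Rf : Module.End ℝ (X → ℝ)} (E : Module.End ℝ (X → ℝ)) (hinv : G * Δa = 1)
    (h291 : Δa * G0 = 1 - R) (hdec : R * E = E * Rs + Rf)
    (hG0 : HasMajorant blk G0 (fun a b => A * (geo i).len a ^ 2 * Real.exp (-(δ * (geo i).dist a b))))
    (hR : HasMajorant blk R (fun a b => θ * Real.exp (-(δ * (geo i).dist a b))))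
    (hG0E : HasMajorant blk (G0 * E) (fun a b => A₀ * (geo i).len a * Real.exp (-(δ * (geo i).dist a b))))
    (hRf : HasMajorant blk Rf (fun a b => θf * ((geo i).len a)⁻¹ * Real.exp (-(δ * (geo i).dist a b))))
    (hRs : HasMajorant blk Rs (fun a b => θs * Real.exp (-((1 - α') * r * (geo i).dist a b)))) :
    HasMajorant blk (G * E)
      (fun a b => (A₀ + A * B6Lemma21Arith.c1Repaired d δ α * (1 - θ * B6Lemma21Arith.c1Repaired d δ α)⁻¹ * θf *
          (geo i).L * B6Lemma21Arith.c1Repaired d r α' ^ 2) *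
        B6Lemma21Arith.c1Repaired d ((1 - α') * r) αs * (1 - θs * B6Lemma21Arith.c1Repaired d ((1 - α') * r) αs)⁻¹ *
        (geo i).len a * Real.exp (-((1 - αs) * ((1 - α') * r) * (geo i).dist a b))) := by
  have h261 : Ineq261With (B6Lemma21Arith.c1Repaired d δ α) (geo i) δ α := (h21 i hH α hα0 hα1 h259).2
  have h263 : Ineq263With (B6Lemma21Arith.c1Repaired d δ α) (geo i) δ α := ineq263With_of_261With htri hδ hα1.le h261
  obtain ⟨h260r, h261r⟩ := h21r i hH α' hα'0 hα'1 h259r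
  have h263r : Ineq263With (B6Lemma21Arith.c1Repaired d r α') (geo i) r α' :=
    ineq263With_of_261With htri hr hα'1.le h261r
  have hConv := B6Prop26ChainGeneric.conv263_of_ineq263With (B6Lemma21Arith.c1Repaired d r α') (geo i) r α' h263r
  have hrc : 0 ≤ (1 - α') * r := mul_nonneg (by linarith) hr
  have h261c : Ineq261With (B6Lemma21Arith.c1Repaired d ((1 - α') * r) αs) (geo i) ((1 - α') * r) αs :=
    (h21c i hH αs hαs0 hαs1 h259c).2
  have h263c : Ineq263With (B6Lemma21Arith.c1Repaired d ((1 - α') * r) αs) (geo i) ((1 - α') * r) αs :=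
    ineq263With_of_261With htri hrc hαs1.le h261c
  have hαδ : 0 ≤ (1 - α) * δ := mul_nonneg (by linarith) hδ
  have hδc : r ≤ δ := by nlinarith
  have hθc : (1 - α') * r ≤ δ := by nlinarith
  have hαθc : 0 ≤ (1 - αs) * ((1 - α') * r) := mul_nonneg (by linarith) hrc
  have hCc : 0 ≤ B6Lemma21Arith.c1Repaired d r α' ^ 2 := pow_nonneg (c1Repaired_nonneg d r α') 2
  have e1 : |(1 : ℝ)| = 1 := abs_one
  have hl1 : (geo i).L ^ |(1 : ℝ)| ≤ Real.exp (α' * r * (geo i).R * (geo i).M) := by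
    rw [e1, Real.rpow_one]; exact hlarge
  have hT := (B6Cor28.transfer_of_260 (geo i).scale (geo i).dist (geo i).L (geo i).eta (α' * r) (geo i).R
    (geo i).M (1 : ℝ) hL hη hl1 h260r).1
  rw [e1, ← B6Cor28.len_eq_rpow] at hT
  have htransfer : ∀ a b : (geo i).Site,
      (geo i).len a ≤ (geo i).L * Real.exp (α' * r * (geo i).dist a b) * (geo i).len b := by
    intro a b
    have h := hT a b
    simp only [Real.rpow_one] at h
    exact h
  have h := prop26_entry3_comm_of_291W blk _ δ α θ A A₀ θf (geo i).L (α' * r) r (B6Lemma21Arith.c1Repaired d r α' ^ 2)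
    ((1 - α') * r) _ αs θs hA hθ (c1Repaired_nonneg d δ α) hαδ htri hrefl hdnn h261 h263 hsmall hA₀ hθf
    (le_trans zero_le_one hL) hL hη htransfer hrate hδc hθc hConv hCc hθs (c1Repaired_nonneg d _ αs) hαθc h261c h263c
    hsmalls E hinv h291 hdec hG0 hR hG0E hRf hRs
  refine hasMajorant_mono blk h fun a b => le_of_eq ?_
  ring

end Repaired

/-! ## §4. THEOREM A on the multi-level tower family: the Lemma-2.1 inputs DISCHARGED by name -/

section Tower

open B6LevelTower (TW twGeo twGeo_hyps266)
open B6TowerSums (Ktw Ktw_nonneg twGeo_ineq261With twGeo_ineq263With)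

variable (d : ℕ) [NeZero d] (k a m L : ℕ) (η R : ℝ)

/-- **THEOREM A ON THE (k+1)-LEVEL TOWER, Lemma 2.1 discharged** — for EVERY tower `twGeo d k a m L η R` (L ≥ 1) and any
rate δ₀ > 0, 0 < α ≤ 1: the (2.61)/(2.63) inputs hold with the tower constant c = K_TW(αδ₀)
(`B6TowerSums.twGeo_ineq261With`/`twGeo_ineq263With`, uniform in k) and (2.54), d(y,y) = 0, d ≥ 0 by the realisation
(`B6LevelTower.twGeo_hyps266`); hence any G′ = G′₀ + G′R on a finite lattice over the tower's 𝔅 whose G′₀ takes sup sources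
to N-outputs with majorant A·P(o)·e^{−δ₀d(y_o,y′)} and whose R has the (2.135)-majorant θe^{−δ₀d}, under the located
smallness θ·K_TW < 1, takes sup sources to N-outputs with majorant A·K_TW·(1 − θK_TW)⁻¹·P(o)·e^{−(1−α)δ₀d(y_o,y′)} — every
output seminorm family N (|·(x)|, |∇·(x)|, ‖ζ∇·‖_α, …).  On these geometries the PRINTED c₁(α) is refuted
(`B6Lemma21TowerD2`, G-B6-01b). [cite: Balaban1984PropagatorsII, Prop. 2.6 (2.136)–(2.141) p.247; Lemma 2.1 (2.61)–(2.63) p.234] -/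
theorem gMajorant_of_fixedPoint_tower (hL : 1 ≤ L) {δ₀ α θ A : ℝ} (hα0 : 0 < α) (hα : α ≤ 1) (hδ₀ : 0 < δ₀)
    (hA : 0 ≤ A) (hθ : 0 ≤ θ)
    {X O : Type} [Fintype X] [DecidableEq X] (blk : X → (twGeo d k a m L η R).Site) (N : O → Seminorm ℝ (X → ℝ))
    (oblk : O → (twGeo d k a m L η R).Site) (P : O → ℝ) (hP : ∀ o, 0 ≤ P o)
    (hsmall : θ * Ktw d L (α * δ₀) < 1)
    {G' G0 Rop : Module.End ℝ (X → ℝ)}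
    (hG0 : GMajorant (blockSrc blk) N G0
      (fun o y' => A * P o * Real.exp (-(δ₀ * (twGeo d k a m L η R).dist (oblk o) y'))))
    (hR : HasMajorant blk Rop (fun y y' => θ * Real.exp (-(δ₀ * (twGeo d k a m L η R).dist y y'))))
    (hfix : G' = G0 + G' * Rop) :
    GMajorant (blockSrc blk) N G' (fun o y' => A * Ktw d L (α * δ₀) * (1 - θ * Ktw d L (α * δ₀))⁻¹ * P o *
      Real.exp (-((1 - α) * δ₀ * (twGeo d k a m L η R).dist (oblk o) y'))) := by
  have hrate : 0 < α * δ₀ := mul_pos hα0 hδ₀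
  obtain ⟨htri, hrefl, hdnn⟩ := twGeo_hyps266 d k a m L η R
  have h261 := twGeo_ineq261With d k a m L η R hL hrate
  have h263 := twGeo_ineq263With d k a m L η R hL hrate hδ₀.le hα
  have hc : 0 ≤ Ktw d L (α * δ₀) := Ktw_nonneg d L hrate (Nat.pos_of_ne_zero (NeZero.ne d))
  have hαδ : 0 ≤ (1 - α) * δ₀ := mul_nonneg (by linarith) hδ₀.le
  exact gMajorant_of_fixedPointW blk N oblk _ δ₀ α θ A P hA hP hθ hc hαδ htri hrefl hdnn h261 h263 hsmall hG0 hR hfix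

end Tower

end Literature.MathematicalPhysics.QuantumFieldTheory.Balaban1983to89.B6Prop26NormsGeneric
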